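import Summits.HodgeConjecture.HodgeConjecture.Theorems.F0P3SpectralPacketG         -- ★ (N) FILE 3a p841253 (F0P3a-p01 (g11)): `SpectralPacketG`, `trS`, FILE 1b `trPktInf`, FILE 1 `trPkt`
import Summits.HodgeConjecture.HodgeConjecture.Theorems.F0P3GlobalPacketRiders       -- ★ (N) FILE 2b p841325 (F0P2-p01 (g9)): `GlobalPacket.ramFinset`
import Literature.NumberTheory.Rogawski1990.TestFunctions                            -- ★ `UnitaryGroup.PureTensor L N H`, `.IsTest`, `.eval` (smooth pure tensors)
import Summits.HodgeConjecture.HodgeConjecture.Theorems.F0P3InnerFormClassificationV6   -- ★ T1/K0 currency: `TestG L = C_c((cmDatum L 3 (splitForm L 3)).Adelic, ℂ)`, `splitForm`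
import HarnessLib

/-!
# (N) DEFS, FILE 2c — THE PRINT LAW OF THE PACKET TRACE ON SMOOTH PURE TENSORS: `Tr Π(f) = Tr Π_∞(f_∞) · ∏_v Tr Π_v(f_v)` as a `Prop` on a CANDIDATE
# functional `trQ : TestG L → ℂ` (Rogawski §13.3 p. 201 first display; §13.7 p. 206; §14.2 p. 233; Flath Thm. 3) — `trG` itself stays a PARAMETER of FILE 3

Cell `hodgecm-mathlib` (D-0151), F0∕P3 «U3-mult», crux H413 (`stmt-HodgeConjecture-24833`), route of record `HCCMUnconditional`.  LEAD F0P3a-plan (g9) T8-94 default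
deal (a) «FILE 2c `trG` on `TestG L`», CENSUS-FIRST: `F0/P2/p01/g9/CENSUS-N-FILE2c-trG-on-TestG.F0P2p01g9.md` (430cce93) — VERDICT C2: the «span ∕ density lemma
for a linear extension of `∏_v trAt`» is NOT a true statement for `TestG L = C_c(G(𝔸))` (the span of smooth pure tensors is `C_c^∞ ⊊ C_c`; print's `Tr Π(f)` on all of
`C_c^∞` is the character of the admissible module `⊗′_v π_v` summed over members, p. 201 — ROAD «TF» at members, which the tree lacks: `exists_isRestrictedTensorProductRep`
has no `_holds`, no arch ⊗ fin integrated trace); RECOMMENDATION C4 (= p01 (g11) census c70774ab (n3-4) alternative): `trG : PG → TestG L → ℂ` STAYS A PARAMETER of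
FILE 3 and its PRINT LAW on smooth pure tensors is TYPED here; LEAD T8-100 (3) «silence by 06:40Z = «=», bytes GO».  F0P2-p01 (g9) pen; namespace of ★ FILE 3a
(`…Cruxes.H413.F0P3SpectralPacket`), new module; definition lane (two `def … : Prop`, parametrised predicates), box-before-file (B-typ04); `--supports
stmt-HodgeConjecture-24833 --as helper`.  No instance, no notation, no named fact, no `sorry`.  `H′ := splitForm L 3` throughout (the carrier of `TestG L`).
HONEST LABEL: HC_CM is proved only modulo the printed citations until rung 0 closes; this file proves no printed statement — it NAMES the law a packet-trace
functional must satisfy; (T) of `K9SpectralLetter` keeps quantifying over arbitrary matched `f ∈ C_c` (print-true: `Tr Π` IS a distribution; booked inside STF-T).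

CONTENTS.
* §1 (TF-Π) `SpectralPacketG.TraceOnPureTensors Q νG archTr trQ` — for every smooth pure tensor `T` at the integral levels (`T.K v = cmLocalIntegralLevel …`) and every
  `F : TestG L` with `⇑F = T.eval`, for tensors whose bad set `T.S ⊇ Π.ramFinset`: `trQ F = Tr Π_∞(T.arch) · ∏_{v ∈ T.S} Tr Π_v(T.loc v)` (★ FILE 1b `trPktInf` × ★ FILE 1
  `trPkt`; off `T.S`, `f_v = 1_{K_v}`, `Π_v` is unramified and print's factor is `1`, which is the separate clause (TF-1)).
* §2 (TF-1) `GlobalPacket.UnramTraceOne Pg νG` — «`Tr Π_v(1_{K_v}) = 1` at an unramified `Π_v`» (p. 201 l. 1–4: `⟨1, π_v⁰⟩ = 1`, `dim (π_v⁰)^{K_v} = 1`, `ν_v(K_v) = 1`).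
* §3 read-backs: `prod_eq_prod_of_subset_of_unramTraceOne` (under (TF-1), enlarging the finite set by places where `f_v = 1_{K_v}` does not change the product),
  `TraceOnPureTensors.eq_prod_of_subset` (the law with any finite `S′ ⊇ T.S`), unfoldings.

References: [Rogawski1990] §13.3 p. 201 (first and second displays, l. 1–4), §13.7 p. 206, §14.2 p. 233; [FlathCorvallis1979] Thm. 3; [CartierCorvallis1979] §IV.1.
-/

set_option autoImplicit false
-- the mandated namespace repeats `HodgeConjecture.HodgeConjecture`, as in every `Theorems/*.lean` of this sub-problem
set_option linter.dupNamespace false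

noncomputable section

open NumberField IsDedekindDomain MeasureTheory
open scoped Matrix MatrixGroups

open Literature.NumberTheory Literature.NumberTheory.Automorphic Literature.NumberTheory.Automorphic.UnitaryGroup
open Literature.NumberTheory.Rogawski1990 Literature.NumberTheory.GaloisRepresentations
open Literature.RepresentationTheory.BorelWallach2000 Literature.RepresentationTheory.KonnoKonno2007
open Summit.HodgeConjecture.HodgeConjecture.Cruxes.H413.F0P3InnerFormClassificationV6 (TestG splitForm)
open Summit.HodgeConjecture.HodgeConjecture.Cruxes.H413.F0P3LocalPacketKit
open Summit.HodgeConjecture.HodgeConjecture.Cruxes.H413.F0P3ArchPacketKit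

/-! ## §2 (TF-1) The unramified normalisation `Tr Π_v(1_{K_v}) = 1` [p. 201 l. 1–4] (stated first: §1's read-backs use it; generic in `H′`; in FILE 2's namespace) -/

namespace Summit.HodgeConjecture.HodgeConjecture.Cruxes.H413.F0P3GlobalPacket.GlobalPacket

variable {L : Type} [Field L] [NumberField L] [IsCMField L]
  {H' : Matrix (Fin 3) (Fin 3) L} {𝔩 : ∀ v : HeightOneSpectrum (𝓞 ↥(maximalRealSubfield L)), LocalPacketKit L H' v}

/-- **(TF-1) «`Tr Π_v(1_{K_v}) = 1` AT AN UNRAMIFIED PLACE OF `Π`»** — print p. 201 l. 1–4: the products `∏_v Tr Π_v(f_v)` are well-defined because for almost all `v`,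
`f_v = 1_{K_v}`, `Π_v` is unramified, only `π_v⁰` has `K_v`-fixed vectors (a line), `⟨1, π_v⁰⟩ = 1` and `ν_v(K_v) = 1`.  A predicate on the kit family, the packet and the
local measures (the kit laws (ℓ1)(ℓ4) + the measure normalisation give it; typed here as the clause consumers assume). [cite: Rogawski1990, §13.3 p. 201 l. 1–4]
[cite: CartierCorvallis1979, §IV.1] -/
def UnramTraceOne (Pg : GlobalPacket 𝔩) [∀ v : HeightOneSpectrum (𝓞 ↥(maximalRealSubfield L)), MeasurableSpace ((cmDatum L 3 H').Local v)]
    (νG : ∀ v : HeightOneSpectrum (𝓞 ↥(maximalRealSubfield L)), Measure ((cmDatum L 3 H').Local v)) : Prop :=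
  ∀ (v : HeightOneSpectrum (𝓞 ↥(maximalRealSubfield L))), (𝔩 v).unr (Pg.loc v) →
    (𝔩 v).trPkt (νG v) (Pg.loc v) ((cmLocalIntegralLevel L 3 H' v : Set ((cmDatum L 3 H').Local v)).indicator fun _ => 1) = 1

/-- Unfolding of (TF-1). [cite: Rogawski1990, §13.3 p. 201 l. 1–4] -/
theorem unramTraceOne_iff (Pg : GlobalPacket 𝔩) [∀ v : HeightOneSpectrum (𝓞 ↥(maximalRealSubfield L)), MeasurableSpace ((cmDatum L 3 H').Local v)]
    (νG : ∀ v : HeightOneSpectrum (𝓞 ↥(maximalRealSubfield L)), Measure ((cmDatum L 3 H').Local v)) :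
    Pg.UnramTraceOne νG ↔ ∀ (v : HeightOneSpectrum (𝓞 ↥(maximalRealSubfield L))), (𝔩 v).unr (Pg.loc v) →
      (𝔩 v).trPkt (νG v) (Pg.loc v) ((cmLocalIntegralLevel L 3 H' v : Set ((cmDatum L 3 H').Local v)).indicator fun _ => 1) = 1 :=
  Iff.rfl

/-- **Under (TF-1), extra unramified places with `f_v = 1_{K_v}` do not change a finite product of local packet traces.** [cite: Rogawski1990, §13.3 p. 201 l. 1–4] -/
theorem prod_eq_prod_of_subset_of_unramTraceOne (Pg : GlobalPacket 𝔩)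
    [∀ v : HeightOneSpectrum (𝓞 ↥(maximalRealSubfield L)), MeasurableSpace ((cmDatum L 3 H').Local v)]
    (νG : ∀ v : HeightOneSpectrum (𝓞 ↥(maximalRealSubfield L)), Measure ((cmDatum L 3 H').Local v)) (h1 : Pg.UnramTraceOne νG)
    (f : ∀ v : HeightOneSpectrum (𝓞 ↥(maximalRealSubfield L)), (cmDatum L 3 H').Local v → ℂ)
    (S S' : Finset (HeightOneSpectrum (𝓞 ↥(maximalRealSubfield L)))) (hSS' : S ⊆ S') (hram : Pg.ramFinset ⊆ S)
    (hf : ∀ v ∈ S', v ∉ S → f v = (cmLocalIntegralLevel L 3 H' v : Set ((cmDatum L 3 H').Local v)).indicator fun _ => 1) :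
    ∏ v ∈ S', (𝔩 v).trPkt (νG v) (Pg.loc v) (f v) = ∏ v ∈ S, (𝔩 v).trPkt (νG v) (Pg.loc v) (f v) := by
  refine (Finset.prod_subset hSS' fun v hvS' hvS => ?_).symm
  rw [hf v hvS' hvS]
  exact h1 v (Pg.unr_of_not_mem_ramFinset fun h => hvS (hram h))

end Summit.HodgeConjecture.HodgeConjecture.Cruxes.H413.F0P3GlobalPacket.GlobalPacket

/-! ## §1 (TF-Π) The packet trace on smooth pure tensors [p. 201 first display; §13.7 p. 206; §14.2 p. 233] (`H′ := splitForm L 3`, the carrier of `TestG L`) -/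

namespace Summit.HodgeConjecture.HodgeConjecture.Cruxes.H413.F0P3SpectralPacket.SpectralPacketG

open Summit.HodgeConjecture.HodgeConjecture.Cruxes.H413.F0P3GlobalPacket

variable {L : Type} [Field L] [NumberField L] [IsCMField L]
  {𝔩 : ∀ v : HeightOneSpectrum (𝓞 ↥(maximalRealSubfield L)), LocalPacketKit L (splitForm L 3) v} {𝔞 : ArchPacketKit}
  {μ : Measure (adelicGroupData (↥(maximalRealSubfield L)) L (IsCMField.complexConj L) 3 (splitForm L 3)).automorphicQuotient}
  [SMulInvariantMeasure (adelicGroupData (↥(maximalRealSubfield L)) L (IsCMField.complexConj L) 3 (splitForm L 3)).Adelic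
    (adelicGroupData (↥(maximalRealSubfield L)) L (IsCMField.complexConj L) 3 (splitForm L 3)).automorphicQuotient μ]

/-- **(TF-Π) «`Tr Π(f) = Tr Π_∞(f_∞) · ∏_v Tr Π_v(f_v)` ON SMOOTH PURE TENSORS»** — the law a CANDIDATE packet-trace functional `trQ : TestG L → ℂ` of the packet `Q` must
satisfy: for every smooth pure tensor `T` (★ `PureTensor`, `T.IsTest`) built at the integral levels (`T.K v = K_v := cmLocalIntegralLevel`) and every `F ∈ C_c(G(𝔸))` with
`⇑F = T.eval`, whose bad set `T.S` CONTAINS `Π.ramFinset` (no loss: a pure tensor can always be presented with a larger bad set, ★ `loc_eq_indicator`; this avoids a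
`DecidableEq` on places), `trQ F = Tr Π_∞(T.arch) · ∏_{v ∈ T.S} Tr Π_v(T.loc v)` (★ FILE 1b `trPktInf` for a given archimedean distribution character `archTr`, ★ FILE 1
`trPkt`; the finite product is print's `∏_v` once (TF-1) holds off `T.S`).  FILE 3 takes `trG` as a parameter with `∀ Q, Q.TraceOnPureTensors νG archTr (trG Q)`.
[cite: Rogawski1990, §13.3 p. 201; §13.7 p. 206; §14.2 p. 233] [cite: FlathCorvallis1979, Thm. 3] -/
def TraceOnPureTensors (Q : SpectralPacketG 𝔩 𝔞 μ)
    [∀ v : HeightOneSpectrum (𝓞 ↥(maximalRealSubfield L)), MeasurableSpace ((cmDatum L 3 (splitForm L 3)).Local v)]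
    (νG : ∀ v : HeightOneSpectrum (𝓞 ↥(maximalRealSubfield L)), Measure ((cmDatum L 3 (splitForm L 3)).Local v))
    (archTr : GKIrrClass (uFormGroup (Fin 2) (Fin 1)) →
      (UnitaryGroup.arch (↥(maximalRealSubfield L)) L (IsCMField.complexConj L) 3 (splitForm L 3) → ℂ) → ℂ)
    (trQ : TestG L → ℂ) : Prop :=
  ∀ (T : UnitaryGroup.PureTensor L 3 (splitForm L 3)), T.IsTest →
    (∀ v : HeightOneSpectrum (𝓞 ↥(maximalRealSubfield L)), T.K v = cmLocalIntegralLevel L 3 (splitForm L 3) v) →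
    Q.fin.ramFinset ⊆ T.S →
    ∀ F : TestG L, ⇑F = T.eval →
      trQ F = 𝔞.trPktInf archTr Q.inf T.arch * ∏ v ∈ T.S, (𝔩 v).trPkt (νG v) (Q.fin.loc v) (T.loc v)

/-- Unfolding of (TF-Π). [cite: Rogawski1990, §13.3 p. 201] -/
theorem traceOnPureTensors_iff (Q : SpectralPacketG 𝔩 𝔞 μ)
    [∀ v : HeightOneSpectrum (𝓞 ↥(maximalRealSubfield L)), MeasurableSpace ((cmDatum L 3 (splitForm L 3)).Local v)]
    (νG : ∀ v : HeightOneSpectrum (𝓞 ↥(maximalRealSubfield L)), Measure ((cmDatum L 3 (splitForm L 3)).Local v))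
    (archTr : GKIrrClass (uFormGroup (Fin 2) (Fin 1)) →
      (UnitaryGroup.arch (↥(maximalRealSubfield L)) L (IsCMField.complexConj L) 3 (splitForm L 3) → ℂ) → ℂ)
    (trQ : TestG L → ℂ) :
    Q.TraceOnPureTensors νG archTr trQ ↔
      ∀ (T : UnitaryGroup.PureTensor L 3 (splitForm L 3)), T.IsTest →
        (∀ v : HeightOneSpectrum (𝓞 ↥(maximalRealSubfield L)), T.K v = cmLocalIntegralLevel L 3 (splitForm L 3) v) →
        Q.fin.ramFinset ⊆ T.S →
        ∀ F : TestG L, ⇑F = T.eval →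
          trQ F = 𝔞.trPktInf archTr Q.inf T.arch * ∏ v ∈ T.S, (𝔩 v).trPkt (νG v) (Q.fin.loc v) (T.loc v) :=
  Iff.rfl

/-- **(TF-Π) with ANY larger finite set**: under (TF-1), for a smooth pure tensor at the integral levels with `Π.ramFinset ⊆ T.S` and any finite `S′ ⊇ T.S`,
`trQ F = Tr Π_∞(T.arch) · ∏_{v ∈ S′} Tr Π_v(T.loc v)` (the extra factors are `Tr Π_v(1_{K_v}) = 1`, ★ `PureTensor.loc_eq_indicator`). [cite: Rogawski1990, §13.3 p. 201 l. 1–4] -/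
theorem TraceOnPureTensors.eq_prod_of_subset {Q : SpectralPacketG 𝔩 𝔞 μ}
    [∀ v : HeightOneSpectrum (𝓞 ↥(maximalRealSubfield L)), MeasurableSpace ((cmDatum L 3 (splitForm L 3)).Local v)]
    {νG : ∀ v : HeightOneSpectrum (𝓞 ↥(maximalRealSubfield L)), Measure ((cmDatum L 3 (splitForm L 3)).Local v)}
    {archTr : GKIrrClass (uFormGroup (Fin 2) (Fin 1)) →
      (UnitaryGroup.arch (↥(maximalRealSubfield L)) L (IsCMField.complexConj L) 3 (splitForm L 3) → ℂ) → ℂ}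
    {trQ : TestG L → ℂ} (h : Q.TraceOnPureTensors νG archTr trQ) (h1 : Q.fin.UnramTraceOne νG)
    (T : UnitaryGroup.PureTensor L 3 (splitForm L 3)) (hT : T.IsTest)
    (hK : ∀ v : HeightOneSpectrum (𝓞 ↥(maximalRealSubfield L)), T.K v = cmLocalIntegralLevel L 3 (splitForm L 3) v)
    (hram : Q.fin.ramFinset ⊆ T.S) (F : TestG L) (hF : ⇑F = T.eval)
    (S' : Finset (HeightOneSpectrum (𝓞 ↥(maximalRealSubfield L)))) (hS' : T.S ⊆ S') :
    trQ F = 𝔞.trPktInf archTr Q.inf T.arch * ∏ v ∈ S', (𝔩 v).trPkt (νG v) (Q.fin.loc v) (T.loc v) := by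
  rw [h T hT hK hram F hF, Q.fin.prod_eq_prod_of_subset_of_unramTraceOne νG h1 T.loc T.S S' hS' hram]
  intro v _ hv
  rw [T.loc_eq_indicator v hv, hK v]

end Summit.HodgeConjecture.HodgeConjecture.Cruxes.H413.F0P3SpectralPacket.SpectralPacketG

end
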